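import Summits.BirchSwinnertonDyer.Rank1Residual.Supersingular.SignedMuVanishing
import Summits.BirchSwinnertonDyer.Rank1Residual.Supersingular.KobayashiSqueezeReal
import Summits.BirchSwinnertonDyer.Rank1Residual.X11a.MuLambdaSplit
import Literature.NumberTheory.EllipticCurves.Kobayashi2003.SignedPAdicLFunctionUniqueProofs
import Literature.NumberTheory.EllipticCurves.PlusMinusPAdicLFunctionProofs
import HarnessLib

/-!
# Route `SignedLowerHalves`, child crux L `SmallImageLowerHalfBothSigns` (item stmt-BirchSwinnertonDyer-23599), line
# `birth_acns` v14, stub `stub_muBothSigns_ns` (the BOTH-signs analytic `μ`-rider): DEDUP — the stub IS the tree's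
# `@[conjecture]` node `Supersingular.SignedMuVanishing` quantified over child L's domain
# (cell `bsd-ssimc`, width seat `bsd-line-slh-p3-w2` gen 2 under LEAD slh-p3; helper `--supports 23599`; THEOREMS ONLY; part 1 of 2)

HONEST FRAMING.  Child L, crux 4 and BSD are OPEN and NOT proved by anything here; no definition, no named fact, no
`sorry`.  Every theorem is an implication whose non-proved inputs are DISPLAYED antecedents: the tree's conjecture node
`SignedMuVanishing W p` (Perrin-Riou 2003 Conj. 6.1.1 / Pollack 2003 Conj. 6.3 on the real objects, typed with census
EVIDENCE by cell `b2b-bsdres`; OPEN), or the text of the registered stub itself (a hypothesis, never asserted).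

Gen 0 of this seat (helper `…MuRiderSignIdle`, p684738) showed the line does not NEED the both-signs rider (the sign of
the integral Eisenstein half is idle on class X7) and classified the rider as conjecture-grade.  This file PINS the
rider to an EXISTING tree object:
* §1 (one pair; `p` odd good, `a_p = 0`, `f` the conductor-level newform): the rider's text
  `∀ ε, ∃ L₀, IsSignedPAdicLFunction f p ε L₀ ∧ HasUnitContent L₀` ⟺ `SignedMuVanishing W p`
  (`signedMuVanishing_iff_forall_sign`) — Pollack pairs are Sprung pairs at trace `0` (`isSprungPair_zero_iff`),
  Kobayashi's `L_p^ε` is unique (`IsSignedPAdicLFunction.unique`), and in `Λ` «`≠ 0 ∧ μ = 0`» is unit content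
  (`X11a.mu_eq_zero_of_hasUnitContent` / `hasUnitContent_of_mu_eq_zero`); plus the UNIT CASE of the rider, input-free
  (`‖[0]⁺_f‖_p = 1` ⟹ both signs, Kurihara's pattern via `signedMuVanishing_of_frobeniusTrace_eq_zero`).
* §2 (class-wide): the registered stub text ⟺ «`SignedMuVanishing W p` at every pair of child L's domain»
  (`muBothSigns_iff_signedMuVanishing_on_domain`).  READING FOR THE PEN (D-0014): a both-signs `μ`-statement, if ever
  wanted as an item, is the EXISTING node (EVIDENCE block in `Rank1Residual/Supersingular/SignedMuVanishing.lean`: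
  window 825/825 two engines, beyond-window 9 076/9 087, X7 rows included) restricted to the domain — not a new
  declaration.  Part 2 (`…MuRiderTwoLayersThree.lean`) reduces the `p = 3` second sign to the two-layer winding span
  of route PrintX8's line «layered Stevens at 3».

References: [PerrinRiou2003] §6.1 Conj. 6.1.1; [Pollack2003] Conj. 6.3, Prop. 6.18; [PollackWeston2011] Thm. 4.1 (1),
Rem. 4.2; [Kobayashi2003] Thm. 3.2, (3.4)–(3.6); [Sprung2017] §3.1; [Kurihara2002] Thm. 0.1; [GreenbergVatsal2000] p. 2 (2);
tree: `Supersingular/SignedMuVanishing.lean` (b2b-bsdres cc-typer-5), `…MuRiderSignIdle.lean` (this seat gen 0).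
-/

-- D-0017: single-problem summit, the namespace repeats the problem name by design.
set_option linter.dupNamespace false
set_option autoImplicit false

noncomputable section

open scoped Classical MatrixGroups ModularForm

open CongruenceSubgroup WeierstrassCurve Literature.NumberTheory.EllipticCurves
  Literature.NumberTheory.EllipticCurves.ModularForms
  Literature.NumberTheory.EllipticCurves.Sprung2017
  Literature.NumberTheory.EllipticCurves.Kobayashi2003
  Literature.NumberTheory.EllipticCurves.GreenbergVatsal2000
  Literature.NumberTheory.EllipticCurves.Rank1Residual
  Summit.BirchSwinnertonDyer.Rank1Residual.X1.MuLambda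
  Summit.BirchSwinnertonDyer.Rank1Residual.Supersingular

namespace Summit.BirchSwinnertonDyer.BirchSwinnertonDyer.Theorems.SmallImageLowerHalfBothSignsMuRiderNode

open Summit.BirchSwinnertonDyer.Rank1Residual.X11a
  (ne_zero_of_hasUnitContent mu_eq_zero_of_hasUnitContent hasUnitContent_of_mu_eq_zero)

/-! ## §1 Dictionary at one pair: the rider's text ⟺ the node `SignedMuVanishing W p` (`a_p = 0`) -/

section Dictionary

variable {W : WeierstrassCurve ℚ} [W.IsElliptic] [W.IsGloballyMinimal] {p : ℕ} [hp : Fact p.Prime]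

omit [W.IsElliptic] in
/-- **Rider ⟹ unit content of every colour of every Sprung pair** (`a_p = 0`, `f` any newform of `W`): if for each
sign `ε` some `L₀ ∈ Λ` satisfies Pollack's parity-`ε` congruences and has unit content, then for every Sprung pair
`(L♯, L♭)` of `f` at `p` (trace `a_p = 0`, i.e. a pair satisfying Pollack's two congruence families,
`isSprungPair_zero_iff`) both `L♯` and `L♭` have unit content — by UNIQUENESS of Kobayashi's `L_p^ε`
(`IsSignedPAdicLFunction.unique`): `L♯ = L₀(−1)`, `L♭ = L₀(1)`.
[cite: Kobayashi2003, Thm. 3.2 and (3.4)–(3.5) (p. 7)] [cite: Sprung2017, §3.1] [cite: Pollack2003, Prop. 6.18] -/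
theorem hasUnitContent_chromaticL_of_forall_sign (hap : W.frobeniusTrace p = 0)
    {N : ℕ} [NeZero N] {f : CuspForm (Gamma0 N) 2}
    (h : ∀ ε : ℤˣ, ∃ L₀ : IwasawaAlgebra p, IsSignedPAdicLFunction f p ε L₀ ∧ HasUnitContent L₀)
    {Lsharp Lflat : IwasawaAlgebra p} (hSP : IsSprungPair f p (W.frobeniusTrace p) Lsharp Lflat)
    (c : Chroma) : HasUnitContent (chromaticL c Lsharp Lflat) := by
  rw [hap] at hSP
  obtain ⟨hodd, heven⟩ := (isSprungPair_zero_iff f p Lsharp Lflat).mp hSP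
  cases c with
  | sharp =>
    obtain ⟨L₀, hL₀, hu⟩ := h (-1)
    have hLs : IsSignedPAdicLFunction f p (-1) Lsharp :=
      (isSignedPAdicLFunction_neg_one_iff f p Lsharp).mpr hodd
    rw [chromaticL_sharp, ← hL₀.unique hLs]
    exact hu
  | flat =>
    obtain ⟨L₀, hL₀, hu⟩ := h 1
    have hLf : IsSignedPAdicLFunction f p 1 Lflat :=
      (isSignedPAdicLFunction_one_iff f p Lflat).mpr heven
    rw [chromaticL_flat, ← hL₀.unique hLf]
    exact hu

/-- **Node ⟹ rider at the pair** (`p` odd, good reduction at `p`, `a_p = 0`, `f` the conductor-level newform): granted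
`SignedMuVanishing W p`, for every sign `ε` some `L₀ ∈ Λ` has Pollack's parity-`ε` congruences and unit content —
namely Kobayashi's `L_p^ε = kobayashiL ε L⁺ L⁻` of a Pollack pair (EXISTS: tree THEOREM
`pollack_exists_plusMinusPAdicLFunction_holds`), which the node makes non-zero with `μ = 0`
(`SignedMuVanishing.kobayashiL_ne_zero_and_mu_eq_zero`), i.e. of unit content.
[cite: PerrinRiou2003, §6.1 Conjecture 6.1.1] [cite: Kobayashi2003, Thm. 3.2 and (3.4)–(3.6) (p. 7)] [cite: GreenbergVatsal2000, p. 2, (2)] -/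
theorem forall_sign_exists_signed_hasUnitContent_of_signedMuVanishing (h : SignedMuVanishing W p)
    (hp2 : p ≠ 2) (hgood : W.HasGoodReductionAtPrime p) (hap : W.frobeniusTrace p = 0)
    [NeZero (W.conductorNorm ℤ)] {f : CuspForm (Gamma0 (W.conductorNorm ℤ)) 2} (hf : IsNewformOf W f)
    (ε : ℤˣ) : ∃ L₀ : IwasawaAlgebra p, IsSignedPAdicLFunction f p ε L₀ ∧ HasUnitContent L₀ := by
  obtain ⟨Lplus, Lminus, hPP⟩ :=
    exists_isPollackPair pollack_exists_plusMinusPAdicLFunction_holds hp2 hf hgood hap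
  obtain ⟨hne, hmu⟩ := h.kobayashiL_ne_zero_and_mu_eq_zero hap hf hPP ε
  exact ⟨kobayashiL ε Lplus Lminus, hPP.isSignedPAdicLFunction_kobayashiL ε,
    hasUnitContent_of_mu_eq_zero hne hmu⟩

/-- **Rider at the conductor-level newform ⟹ node.** [cite: PerrinRiou2003, §6.1 Conjecture 6.1.1]
[cite: Kobayashi2003, Thm. 3.2 (p. 7)] [cite: GreenbergVatsal2000, p. 2, (2)] -/
theorem signedMuVanishing_of_forall_sign_exists_signed_hasUnitContent (hap : W.frobeniusTrace p = 0)
    [NeZero (W.conductorNorm ℤ)] {f₀ : CuspForm (Gamma0 (W.conductorNorm ℤ)) 2} (hf₀ : IsNewformOf W f₀)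
    (h : ∀ ε : ℤˣ, ∃ L₀ : IwasawaAlgebra p, IsSignedPAdicLFunction f₀ p ε L₀ ∧ HasUnitContent L₀) :
    SignedMuVanishing W p := by
  intro _ f hf Lsharp Lflat hSP c
  obtain rfl : f = f₀ := hf.unique hf₀
  have hu := hasUnitContent_chromaticL_of_forall_sign hap h hSP c
  exact ⟨ne_zero_of_hasUnitContent hu, mu_eq_zero_of_hasUnitContent hu⟩

/-- **THE DICTIONARY**: at an odd good prime `p` with `a_p = 0` and the conductor-level newform `f` of `W`, the
node `SignedMuVanishing W p` ⟺ the rider's text `∀ ε, ∃ L₀, IsSignedPAdicLFunction f p ε L₀ ∧ HasUnitContent L₀`.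
[cite: PerrinRiou2003, §6.1 Conjecture 6.1.1] [cite: PollackWeston2011, Rem. 4.2] [cite: Kobayashi2003, Thm. 3.2 (p. 7)] -/
theorem signedMuVanishing_iff_forall_sign (hp2 : p ≠ 2) (hgood : W.HasGoodReductionAtPrime p)
    (hap : W.frobeniusTrace p = 0) [NeZero (W.conductorNorm ℤ)]
    {f : CuspForm (Gamma0 (W.conductorNorm ℤ)) 2} (hf : IsNewformOf W f) :
    SignedMuVanishing W p ↔
      ∀ ε : ℤˣ, ∃ L₀ : IwasawaAlgebra p, IsSignedPAdicLFunction f p ε L₀ ∧ HasUnitContent L₀ :=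
  ⟨fun h ε ↦ forall_sign_exists_signed_hasUnitContent_of_signedMuVanishing h hp2 hgood hap hf ε,
    signedMuVanishing_of_forall_sign_exists_signed_hasUnitContent hap hf⟩

/-- **The unit case of the rider, input-free** (Kurihara's pattern, any odd good `p` with `a_p = 0`): if
`‖[0]⁺_f‖_p = 1` (`[0]⁺_f = L(E,1)/Ω⁺_f` a `p`-adic unit — analytic rank `0`) then BOTH signs have unit content
(indeed `L_p^± ∈ Λˣ`: `signedMuVanishing_of_frobeniusTrace_eq_zero`).  On the census these are the rank-0 pairs with
`ord_p(L(E,1)/Ω⁺_f) = 0`: no Mazur–Tate layer is needed there. [cite: Kurihara2002, Thm. 0.1] [cite: Kobayashi2003, (3.6) (p. 7)] -/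
theorem forall_sign_exists_signed_hasUnitContent_of_norm_ratPlusSymbol_zero_eq_one (hp2 : p ≠ 2)
    (hgood : W.HasGoodReductionAtPrime p) (hap : W.frobeniusTrace p = 0) [NeZero (W.conductorNorm ℤ)]
    {f : CuspForm (Gamma0 (W.conductorNorm ℤ)) 2} (hf : IsNewformOf W f)
    (h0 : ‖((ratPlusSymbol f 0 : ℚ) : ℚ_[p])‖ = 1) (ε : ℤˣ) :
    ∃ L₀ : IwasawaAlgebra p, IsSignedPAdicLFunction f p ε L₀ ∧ HasUnitContent L₀ := by
  have hpP : p.Prime := hp.out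
  have hr : ratPlusSymbol f 0 ≠ 0 := by
    intro hz
    rw [hz, Rat.cast_zero, norm_zero] at h0
    exact zero_ne_one h0
  have hv : padicValRat p (ratPlusSymbol f 0) = 0 := by
    rw [Padic.eq_padicNorm, padicNorm.eq_zpow_of_nonzero hr] at h0
    have h0' : ((p : ℚ) ^ (-padicValRat p (ratPlusSymbol f 0)) : ℚ) = 1 := by exact_mod_cast h0
    have hp0 : (0 : ℚ) ≤ p := by positivity
    have hp1 : (p : ℚ) ≠ 1 := by exact_mod_cast hpP.ne_one
    have h3 := (zpow_eq_one_iff_right₀ hp0 hp1).mp h0'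
    omega
  exact forall_sign_exists_signed_hasUnitContent_of_signedMuVanishing
    (signedMuVanishing_of_frobeniusTrace_eq_zero hp2 hgood hap hf hr hv) hp2 hgood hap hf ε

end Dictionary

/-! ## §2 DEDUP: the registered stub `stub_muBothSigns_ns` ⟺ the node on child L's domain -/

section Domain

/-- **The registered v14 stub `stub_muBothSigns_ns` of line `birth_acns` on child L (its statement VERBATIM, as the
left-hand side) IS the tree's conjecture node `SignedMuVanishing` quantified over child L's domain** (odd `p`,
`ClassX7`, non-CM, `a_p = 0`, `ρ̄_{E,p}` not onto).  The class binders `¬CM`, `¬Surj` are idle on both sides; only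
good reduction (from `ClassX7`) and `a_p = 0` are used.  READING FOR THE PEN (D-0014): a both-signs `μ`-item would be
this EXISTING `@[conjecture]` node restricted to the domain (its EVIDENCE block lives in
`Rank1Residual/Supersingular/SignedMuVanishing.lean`), never a new declaration.
[cite: PerrinRiou2003, §6.1 Conjecture 6.1.1] [cite: PollackWeston2011, Rem. 4.2] [cite: Kobayashi2003, Thm. 3.2 (p. 7)] -/
theorem muBothSigns_iff_signedMuVanishing_on_domain :
    (∀ (W : WeierstrassCurve ℚ) [W.IsElliptic] [W.IsGloballyMinimal] (p : ℕ) [Fact p.Prime],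
      p ≠ 2 → ClassX7 W p → ¬ W.HasCM → W.frobeniusTrace p = 0 → ¬ Surj W p →
      ∀ [NeZero (W.conductorNorm ℤ)] (f : CuspForm (Gamma0 (W.conductorNorm ℤ)) 2),
      IsNewformOf W f → ∀ ε : ℤˣ, ∃ L₀ : IwasawaAlgebra p,
        IsSignedPAdicLFunction f p ε L₀ ∧ HasUnitContent L₀) ↔
    (∀ (W : WeierstrassCurve ℚ) [W.IsElliptic] [W.IsGloballyMinimal] (p : ℕ) [Fact p.Prime],
      p ≠ 2 → ClassX7 W p → ¬ W.HasCM → W.frobeniusTrace p = 0 → ¬ Surj W p →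
      SignedMuVanishing W p) := by
  constructor
  · intro h W _ _ p _ hp2 hX hCM hap hs _ f hf Lsharp Lflat hSP c
    have hu := hasUnitContent_chromaticL_of_forall_sign hap (h W p hp2 hX hCM hap hs f hf) hSP c
    exact ⟨ne_zero_of_hasUnitContent hu, mu_eq_zero_of_hasUnitContent hu⟩
  · intro h W _ _ p _ hp2 hX hCM hap hs _ f hf ε
    exact forall_sign_exists_signed_hasUnitContent_of_signedMuVanishing (h W p hp2 hX hCM hap hs) hp2
      hX.1.1 hap hf ε

end Domain

end Summit.BirchSwinnertonDyer.BirchSwinnertonDyer.Theorems.SmallImageLowerHalfBothSignsMuRiderNode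

end
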